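import Literature.Analysis.FluidPDE.NewtonPotentialTestSource
import Literature.Analysis.FluidPDE.NormalisedPressureLpBoundProofs
import Literature.Analysis.FluidPDE.SpaceTimeMollifier
import HarnessLib

/-!
# The Calderón–Zygmund `L^p` bound for second derivatives of the Newtonian potential of a
test density (Stein 1970, Ch. II §4.2 Thm. 3; Ch. III §1.3 Prop. 3)

Analysis/FluidPDE support file (theorems only) in the decomposition of the named fact
`Literature.Analysis.FluidPDE.leray_solution_ckn_decay` (Kang–Miura–Tsai 2021, Lemmas 3.3–3.4)
through the slice oscillation estimate of `LerayPressureDecayReduction.lean`. The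
Calderón–Zygmund input of the local pressure expansion (Kang–Miura–Tsai, arXiv:1812.10509,
App. 1 p. 18: "By the Calderon–Zygmund estimate,
`∫_{B_{3R/2}(x₀)} |p_loc|^q ≤ c_q ∫_{B_{3R}(x₀)} |v|^{2q}`") is consumed in the tree's route by
**duality**: the near-field potential `N[s]`, `s = -∑ ∂ᵢ∂ⱼ(ψFᵢⱼ)`, is paired with a test density
`ρ`, `∫ N[s] ρ = -∑ ∫ (ψFᵢⱼ) ∂ᵢ∂ⱼN[ρ]` (`NewtonPotentialTestSource`), so that only the bound

  `‖∂ᵤ∂ᵥ N[ρ]‖_{L^p} = ‖N[∂ᵤ∂ᵥρ]‖_{L^p} ≤ C_p ‖ρ‖_{L^p}`,  `ρ ∈ C^∞_c(ℝ³)`, `1 < p < ∞`,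

on **smooth compactly supported** densities is needed (Stein 1970, Ch. III §1.3, Prop. 3:
"`‖∂²f/∂xⱼ∂xₖ‖_p ≤ A_p ‖Δf‖_p`", here with `f = N[ρ]`, `Δf = ρ`). This file proves it from
the tree's uniform Calderón–Zygmund theorem for the regularised Hessian convolutions
(`exists_eLpNorm_hessConv_le`, `NormalisedPressureLpBoundProofs.lean`, itself proved in
`Analysis/SingularIntegrals/`): `N[∂ₐ∂ₐρ](x) = lim_{ε→0⁺} H^a_ε[ρ](x)` pointwise
(`hessConv_eq_integral_newtonReg_mul`, `tendsto_integral_newtonReg_mul`), Fatou along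
`ε = 1/(n+1)`, and polarisation for mixed directions.

* `exists_eLpNorm_convolution_fderiv2_newtonKernel_le` — pure second directional derivatives
  `∂ₐ∂ₐ`, `|a| ≤ 2`;
* `exists_eLpNorm_convolution_mixed_fderiv2_newtonKernel_le` — mixed `∂ᵤ∂ᵥ`, `|u|, |v| ≤ 1`.

## References

* E. M. Stein, *Singular integrals and differentiability properties of functions* (1970),
  Ch. II §4.2 Thm. 3; Ch. III §1.3 Prop. 3 (p. 59). [Stein1971]
* K. Kang, H. Miura, T.-P. Tsai, IMRN 2021 = arXiv:1812.10509, App. 1 p. 18. [KangMiuraTsai2020]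
-/

noncomputable section

open MeasureTheory Set Filter Topology Function Metric ContinuousLinearMap
open scoped ENNReal NNReal Convolution ContDiff

namespace Literature.Analysis.FluidPDE

section CZ

variable {ρ : EuclideanSpace ℝ (Fin 3) → ℝ}

/-- The second directional derivative `∂ᵥ∂ᵤρ` of a `C^∞` function is `C^∞`. [folklore] -/
theorem contDiff_fderiv_fderiv_apply (hρ : ContDiff ℝ ∞ ρ) (u v : EuclideanSpace ℝ (Fin 3)) :
    ContDiff ℝ ∞ fun t => fderiv ℝ (fun s => fderiv ℝ ρ s u) t v :=
  contDiff_fderiv_apply_const (contDiff_fderiv_apply_const hρ u) v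

/-- **The potential of a second derivative is the limit of the regularised Hessian
convolutions**: `N[∂ₐ∂ₐρ](x) = lim_{n→∞} H^a_{1/(n+1)}[ρ](x)` for `ρ ∈ C^∞_c`. [cite: Stein1971, Ch. III §1.3 Prop. 3 (proof)] -/
theorem tendsto_hessConv_nat (hρ : ContDiff ℝ ∞ ρ) (hρc : HasCompactSupport ρ)
    (a x : EuclideanSpace ℝ (Fin 3)) :
    Tendsto (fun n : ℕ => hessConv (1 / ((n : ℝ) + 1)) ρ a x) atTop
      (𝓝 (((fun t => fderiv ℝ (fun s => fderiv ℝ ρ s a) t a) ⋆[lsmul ℝ ℝ, volume]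
        newtonKernel) x)) := by
  have hg : Continuous fun t => fderiv ℝ (fun s => fderiv ℝ ρ s a) t a :=
    (contDiff_fderiv_fderiv_apply hρ a a).continuous
  have hgc := hasCompactSupport_fderiv_fderiv_apply hρc a a
  have h1 := tendsto_integral_newtonReg_mul hg hgc x
  rw [← convolution_newtonKernel_apply'] at h1
  have h2 : (fun ε => ∫ t, newtonReg ε (x - t) * fderiv ℝ (fun s => fderiv ℝ ρ s a) t a) =
      fun ε => hessConv ε ρ a x :=
    funext fun ε => (hessConv_eq_integral_newtonReg_mul ε (hρ.of_le two_le_infty) hρc a x).symm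
  rw [h2] at h1
  refine h1.comp ?_
  rw [tendsto_nhdsWithin_iff]
  exact ⟨tendsto_one_div_add_atTop_nhds_zero_nat,
    Eventually.of_forall fun n => mem_Ioi.2 (one_div_pos.2 (Nat.cast_add_one_pos n))⟩

/-- **Calderón–Zygmund bound for pure second derivatives of the Newtonian potential of a test
density** (Stein 1970, Ch. II §4.2 Thm. 3 / Ch. III §1.3 Prop. 3): for `1 < p < ∞` there is
`C = C(p)` with `‖N[∂ₐ∂ₐρ]‖_{L^p} ≤ C ‖ρ‖_{L^p}` for all `|a| ≤ 2` and `ρ ∈ C^∞_c(ℝ³)`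
(Fatou along the regularised Hessian convolutions, `exists_eLpNorm_hessConv_le`).
[cite: Stein1971, Ch. II §4.2 Thm 3 with Ch. III §1.3 Prop 3] -/
theorem exists_eLpNorm_convolution_fderiv2_newtonKernel_le {p : ℝ≥0∞} (hp1 : 1 < p)
    (hp2 : p < ⊤) :
    ∃ C : ℝ≥0, ∀ a : EuclideanSpace ℝ (Fin 3), ‖a‖ ≤ 2 →
      ∀ ρ : EuclideanSpace ℝ (Fin 3) → ℝ, ContDiff ℝ ∞ ρ → HasCompactSupport ρ →
        eLpNorm ((fun t => fderiv ℝ (fun s => fderiv ℝ ρ s a) t a) ⋆[lsmul ℝ ℝ, volume]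
          newtonKernel) p volume ≤ C * eLpNorm ρ p volume := by
  obtain ⟨C, hC⟩ := exists_eLpNorm_hessConv_le hp1 hp2
  refine ⟨C, fun a ha ρ hρ hρc => ?_⟩
  have hFatou := Lp.eLpNorm_lim_le_liminf_eLpNorm (μ := volume) (p := p)
    (f := fun n : ℕ => hessConv (1 / ((n : ℝ) + 1)) ρ a)
    (fun n => aestronglyMeasurable_hessConv _ hρ.continuous a)
    (((fun t => fderiv ℝ (fun s => fderiv ℝ ρ s a) t a) ⋆[lsmul ℝ ℝ, volume] newtonKernel))
    (Eventually.of_forall fun x => tendsto_hessConv_nat hρ hρc a x)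
  refine hFatou.trans (liminf_le_of_frequently_le' (Eventually.of_forall fun n => ?_).frequently)
  exact hC _ (one_div_pos.2 (Nat.cast_add_one_pos n)) a ha ρ hρ.continuous hρc

/-- **Polarisation of second directional derivatives**: for `ρ ∈ C²`,
`∂ᵥ∂ᵤρ = ½(∂_{u+v}∂_{u+v}ρ - ∂ᵤ∂ᵤρ - ∂ᵥ∂ᵥρ)` (bilinearity and Schwarz). [folklore] -/
theorem fderiv_fderiv_apply_polarisation (hρ : ContDiff ℝ 2 ρ) (t u v : EuclideanSpace ℝ (Fin 3)) :
    fderiv ℝ (fun s => fderiv ℝ ρ s u) t v =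
      2⁻¹ * (fderiv ℝ (fun s => fderiv ℝ ρ s (u + v)) t (u + v) -
        fderiv ℝ (fun s => fderiv ℝ ρ s u) t u - fderiv ℝ (fun s => fderiv ℝ ρ s v) t v) := by
  have hd : DifferentiableAt ℝ (fderiv ℝ ρ) t :=
    ((hρ.fderiv_right (m := 1) le_rfl).differentiable one_ne_zero) t
  have hsymm : fderiv ℝ (fderiv ℝ ρ) t v u = fderiv ℝ (fderiv ℝ ρ) t u v := by
    have := fderiv_fderiv_apply_comm hρ t v u
    rwa [fderiv_apply_const_apply hd, fderiv_apply_const_apply hd] at this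
  rw [fderiv_apply_const_apply hd, fderiv_apply_const_apply hd, fderiv_apply_const_apply hd,
    fderiv_apply_const_apply hd]
  simp only [map_add, FunLike.coe_add, Pi.add_apply]
  rw [hsymm]
  ring

/-- **Calderón–Zygmund bound for mixed second derivatives of the Newtonian potential of a
test density**: for `1 < p < ∞` there is `C = C(p)` with `‖N[∂ᵥ∂ᵤρ]‖_{L^p} ≤ C ‖ρ‖_{L^p}` for
all `|u|, |v| ≤ 1` and `ρ ∈ C^∞_c(ℝ³)` (polarisation and the pure-direction bound with
`|u + v| ≤ 2`). [cite: Stein1971, Ch. II §4.2 Thm 3 with Ch. III §1.3 Prop 3] -/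
theorem exists_eLpNorm_convolution_mixed_fderiv2_newtonKernel_le {p : ℝ≥0∞} (hp1 : 1 < p)
    (hp2 : p < ⊤) :
    ∃ C : ℝ≥0, ∀ u v : EuclideanSpace ℝ (Fin 3), ‖u‖ ≤ 1 → ‖v‖ ≤ 1 →
      ∀ ρ : EuclideanSpace ℝ (Fin 3) → ℝ, ContDiff ℝ ∞ ρ → HasCompactSupport ρ →
        eLpNorm ((fun t => fderiv ℝ (fun s => fderiv ℝ ρ s u) t v) ⋆[lsmul ℝ ℝ, volume]
          newtonKernel) p volume ≤ C * eLpNorm ρ p volume := by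
  obtain ⟨C, hC⟩ := exists_eLpNorm_convolution_fderiv2_newtonKernel_le hp1 hp2
  refine ⟨2⁻¹ * (3 * C), fun u v hu hv ρ hρ hρc => ?_⟩
  have hp1' : 1 ≤ p := hp1.le
  -- the three pure potentials
  set g : EuclideanSpace ℝ (Fin 3) → EuclideanSpace ℝ (Fin 3) → ℝ := fun c t =>
    fderiv ℝ (fun s => fderiv ℝ ρ s c) t c with hg
  have hgc : ∀ c, Continuous (g c) := fun c => (contDiff_fderiv_fderiv_apply hρ c c).continuous
  have hgs : ∀ c, HasCompactSupport (g c) := fun c => hasCompactSupport_fderiv_fderiv_apply hρc c c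
  set N : EuclideanSpace ℝ (Fin 3) → EuclideanSpace ℝ (Fin 3) → ℝ := fun c =>
    g c ⋆[lsmul ℝ ℝ, volume] newtonKernel with hN
  have hNm : ∀ c, AEStronglyMeasurable (N c) volume := fun c =>
    (contDiff_convolution_newtonKernel (contDiff_fderiv_fderiv_apply hρ c c)
      (hgs c)).continuous.aestronglyMeasurable
  have hNb : ∀ c, ‖c‖ ≤ 2 → eLpNorm (N c) p volume ≤ C * eLpNorm ρ p volume := fun c hc =>
    hC c hc ρ hρ hρc
  -- the mixed potential is the polarisation combination of the pure ones
  have hint : ∀ c x, Integrable fun t => g c t * newtonKernel (x - t) := fun c x =>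
    (integrable_newtonKernel_mul (hgc c) (hgs c) x).congr
      (Eventually.of_forall fun t => mul_comm _ _)
  have hpol : ((fun t => fderiv ℝ (fun s => fderiv ℝ ρ s u) t v) ⋆[lsmul ℝ ℝ, volume]
      newtonKernel) = (2⁻¹ : ℝ) • fun x => (N (u + v) x - N u x - N v x) := by
    funext x
    rw [convolution_lsmul_apply, Pi.smul_apply, smul_eq_mul]
    have e1 : ∀ c, N c x = ∫ t, g c t * newtonKernel (x - t) := fun c =>
      convolution_lsmul_apply _ _ _
    have e2 : ∫ t, fderiv ℝ (fun s => fderiv ℝ ρ s u) t v * newtonKernel (x - t) =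
        ∫ t, 2⁻¹ * (g (u + v) t * newtonKernel (x - t) - g u t * newtonKernel (x - t) -
          g v t * newtonKernel (x - t)) := by
      refine integral_congr_ae (Eventually.of_forall fun t => ?_)
      dsimp only
      rw [fderiv_fderiv_apply_polarisation (hρ.of_le two_le_infty) t u v, hg]
      ring
    rw [e1, e1, e1, e2, integral_const_mul,
      integral_sub (f := fun t => g (u + v) t * newtonKernel (x - t) - g u t * newtonKernel (x - t))
        (g := fun t => g v t * newtonKernel (x - t)) ((hint (u + v) x).sub (hint u x)) (hint v x),
      integral_sub (hint (u + v) x) (hint u x)]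
  rw [hpol]
  have huv : ‖u + v‖ ≤ 2 := (norm_add_le u v).trans (by linarith)
  have hu2 : ‖u‖ ≤ 2 := hu.trans (by norm_num)
  have hv2 : ‖v‖ ≤ 2 := hv.trans (by norm_num)
  calc eLpNorm ((2⁻¹ : ℝ) • fun x => (N (u + v) x - N u x - N v x)) p volume
      = ‖(2⁻¹ : ℝ)‖ₑ * eLpNorm (fun x => N (u + v) x - N u x - N v x) p volume :=
        eLpNorm_const_smul (2⁻¹ : ℝ) (fun x => N (u + v) x - N u x - N v x) p volume
    _ ≤ ‖(2⁻¹ : ℝ)‖ₑ * (eLpNorm (N (u + v)) p volume + eLpNorm (N u) p volume +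
          eLpNorm (N v) p volume) := by
        gcongr
        calc eLpNorm (fun x => N (u + v) x - N u x - N v x) p volume
            ≤ eLpNorm (fun x => N (u + v) x - N u x) p volume + eLpNorm (N v) p volume :=
              eLpNorm_sub_le ((hNm _).sub (hNm _)) (hNm _) hp1'
          _ ≤ (eLpNorm (N (u + v)) p volume + eLpNorm (N u) p volume) +
              eLpNorm (N v) p volume := by
              gcongr
              exact eLpNorm_sub_le (hNm _) (hNm _) hp1'
    _ ≤ ‖(2⁻¹ : ℝ)‖ₑ * (C * eLpNorm ρ p volume + C * eLpNorm ρ p volume +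
          C * eLpNorm ρ p volume) := by
        gcongr
        · exact hNb _ huv
        · exact hNb _ hu2
        · exact hNb _ hv2
    _ = ((2⁻¹ * (3 * C) : ℝ≥0) : ℝ≥0∞) * eLpNorm ρ p volume := by
        rw [Real.enorm_eq_ofReal (by norm_num), ENNReal.ofReal_inv_of_pos (by norm_num),
          ENNReal.ofReal_ofNat]
        push_cast
        ring

end CZ

end Literature.Analysis.FluidPDE
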